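import Summits.ResolutionOfSingularities.ResolutionOfSingularities.Theorems.HilbertSamuelEliminationCampaignW42PermissibleConeDictionary
import Summits.ResolutionOfSingularities.ResolutionOfSingularities.Theorems.HilbertSamuelEliminationCampaignW42PermissibleNearEqualities
import Literature.AlgebraicGeometry.Resolution.RidgeCone
import HarnessLib

/-!
# [OURS · L1 W4.2] RIDGE CONFINEMENT FOR AN ARBITRARY PERMISSIBLE CENTRE: a near point `x'` of the blow-up of
# `Spec 𝒪` along a permissible `𝔭 = (c_1, …, c_n)` has its direction `(c_l/c_j)(x') ∈ κ(x')ⁿ` in Giraud's ridge of the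
# fibre cone `C_{X,D,x} = Spec(gr_𝔭 𝒪 ⊗ k)` — every point of the fibre, every residue field, every characteristic
# (campaign s42, cell res-hironaka; informal crux `RidgeConfinement`, stmt-ResolutionOfSingularities-17845; `--supports`)

HONEST FRAMING. OURS (slot W4.2, prover res-L1-s42-pv-1, gen 3): the assembly of this campaign's general case. Let
`(𝒪, 𝔫, k)` be a noetherian, universally catenary local ring (`= 𝒪_{X,x}`), `𝔭 = (c_1, …, c_n)` PERMISSIBLE (`𝔭` prime,
`𝒪/𝔭` regular, `𝒪` normally flat along `𝔭` — CJS Def. 3.1 at `x`), `C = 𝒪[𝔭/c_j]` the `j`-th chart of the blow-up of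
`Spec 𝒪` along `𝔭` (`Resolution.chartRing c j`), `P ⊆ C` a prime over `𝔫` (a point `x'` of the fibre over `x` — closed
or not, with any residue field) and `𝒪' = C_P`. Suppose `x'` is NEAR at level `N`:
`H⁽ᴺ⁻ψ(𝒪')⁾(𝒪') = H⁽ᴺ⁻ψ(𝒪)⁾(𝒪)` (`CampaignW42.IsNearRing 𝒪 𝒪' N`, the typed OURS nearness of
`…CampaignW42RidgeConfinement.lean`, p480040 = CJS Def. 3.13 / 2.28 in the local rings). Then:

* **`CampaignW42.ridgeIdeal_fibreConeIdeal_le_chartConePrime_of_isNearRing`** — the homogeneous prime `𝔓(P) ⊆ k[Y]`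
  of the line of the fibre cone through `x'` contains the ideal of the ridge: `ridgeIdeal (I(c)) ⊆ 𝔓(P)`, i.e.
  **`x' ∈ ℙ(F(C_{X,D,x}))` scheme-theoretically** (`I(c) = fibreConeIdeal c` the homogeneous ideal of
  `C_{X,D,x} ⊆ N_x = Spec k[Y_1, …, Y_n]`);
* **`CampaignW42.aeval_chartGen_mem_ridge_of_isNearRing`** — for every test ring `κ` (a commutative `k`-algebra) and
  every `θ : C → κ` killing `P` and compatible with `k → κ`, the DIRECTION `(θ(e_1), …, θ(e_n)) ∈ κⁿ`,
  `e_l = c_l/c_j = chartGen c j l` (`θ(e_j) = 1`), lies in Giraud's ridge `F(C_{X,D,x})(κ) = ridge κ (I(c))`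
  (translation by it preserves `I(c) ⊗ κ`);
* **`CampaignW42.residue_chartGen_mem_ridge_of_isNearRing`** — in particular at `κ = κ(P) = κ(x')` with the `k`-algebra
  structure induced by `𝒪 → C → κ(P)` (the shape of the typed OURS `CampaignW42.RidgeConfinesChart`, p480040, with the
  FIBRE-CONE ridge `F(C_{X,D,x}) ⊆ N_x` in place of the tangent-cone ridge `F_x(X) ⊆ T_x(X)`; by Hironaka–Grothendieck,
  `C_x(X) = C_{X,D,x} × T_x(D)` for permissible `D`, so `ℙ(F(C_{X,D,x})) = ℙ(F_x(X)/T_x(D))` — that identification with the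
  tree's `localRidge` is NOT made in this file).

This is CJS Thm. 3.14 WITHOUT the hypothesis «`char κ(x) = 0` or `≥ dim X/2 + 1`», with the RIDGE in place of the
directrix (Giraud 1975 Cor. 2.4 / CJS Rem. 18.29 (1) in print), for an ARBITRARY permissible centre, at EVERY point of
the fibre and for EVERY residue field — the informal crux O1 (`RidgeConfinement`, stmt-17845) at the level of local rings
and `κ(x')`-points. Proof = this campaign's chain: near ⟹ Bennett EQUALITY at the line `𝔮 = coneLocalPrime` of the fibre
cone (`…PermissibleNearEqualities`, from the tree's `PermissibleBlowupHilbertSamuelLocal`) ⟹ read on the coordinate cone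
`V(I(c))` at the prime `𝔓(P)` (`…FibreConePresentation`, `…PermissibleConeDictionary`) ⟹ `ridgeIdeal I(c) ⊆ 𝔓(P)` by the
cone theorem at an arbitrary point (`…ConeRidgePrime`: Bennett propagation + gen 2's closed-point theorem
`…ConeRidgeClosedPoint` + Jacobson) ⟹ evaluate the (homogeneous) ridge equations on the direction.

NOTHING here is a statement of H. Hironaka's manuscript [Hironaka2017]; nothing of it is used. AI review is weaker than
expert review. References (orientation only): V. Cossart, U. Jannsen, S. Saito, LNM 2270 (2020), Def. 2.28, Def. 3.1,
Thm. 3.10, Def. 3.13, Thm. 3.14, Rem. 18.29; J. Giraud, Ann. Sci. ÉNS (4) 8 (1975), §1.5, Cor. 2.4; H. Hironaka,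
Ann. of Math. 92 (1970).
-/

noncomputable section

-- single-conjunct summit: the doubled namespace component `ResolutionOfSingularities` is mandated
set_option linter.dupNamespace false
-- quotients of localizations of `k[Y]/I` need one more level of nested instance synthesis (as in `…ConeRidgePrime`)
set_option maxSynthPendingDepth 3

open IsLocalRing MvPolynomial
open Literature.RingTheory.HilbertSamuel
open Literature.AlgebraicGeometry.Resolution

namespace Summit.ResolutionOfSingularities.ResolutionOfSingularities.Theorems

namespace CampaignW42

universe u

variable {O : Type u} [CommRing O] [IsLocalRing O] [IsNoetherianRing O] {n : ℕ} (c : Fin n → O) (j : Fin n)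

local notation3 "𝔭" => Ideal.span (Set.range c)
local notation3 "hcj" => Ideal.mem_span_range_self (f := c) (x := j)

variable (P : Ideal (chartRing c j)) [P.IsPrime]
variable (O' : Type u) [CommRing O'] [Algebra (chartRing c j) O'] [IsLocalization.AtPrime O' P]
  [IsLocalRing O'] [Algebra O O']

/-- **`x' ∈ ℙ(F(C_{X,D,x}))`, scheme-theoretically**: at a near point of the blow-up along a permissible centre, the
homogeneous prime `𝔓(P) ⊆ k[Y]` of the line of the fibre cone through `x' ↔ P` contains the ideal of Giraud's ridge of
the fibre cone: `ridgeIdeal (fibreConeIdeal c) ⊆ chartConePrime c j P`. [cite: CossartJannsenSaito2020, Thm. 3.14] -/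
theorem ridgeIdeal_fibreConeIdeal_le_chartConePrime_of_isNearRing (hO : IsUniversallyCatenaryRing O) [(𝔭).IsPrime]
    [IsRegularLocalRing (O ⧸ 𝔭)] (hNF : (𝔭).IsNormallyFlat)
    (hP : P.comap (chartBase c j) = maximalIdeal O)
    (hOO' : ∀ r : O, algebraMap O O' r = (algebraMap (chartRing c j) O' : chartRing c j →+* O') (chartBase c j r))
    {N : ℕ} (hnear : IsNearRing O O' N) :
    ridgeIdeal (fibreConeIdeal c) ≤ chartConePrime c j P := by
  haveI := isPrime_coneLocalPrime (c j) hcj P hP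
  haveI := isPrime_chartConePrime c j P hP
  set I := fibreConeIdeal c
  obtain ⟨d, hd⟩ := exists_ringKrullDim_quotient_eq_nat (FibreConeLocal (𝔭)) (coneLocalPrime (c j) hcj P)
  -- Bennett equality at the line of the fibre cone, read on the coordinate cone `V(I(c))` at `𝔓(P)`
  have hB := hilbertSamuelFun_coneLocalPrime_eq_of_isNearRing c j P O' hO hNF hP hOO' hnear hd 0
  rw [hilbertSamuelFun_zero, hilbertFun_fibreConeLocal_eq_hilbertFunQuot c] at hB
  have hdS : ringKrullDim (MvPolynomial (Fin n) (ResidueField O) ⧸ chartConePrime c j P) = d :=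
    (ringKrullDim_quotient_chartConePrime_eq c j P hP).trans hd
  letI := algebraOfFibreCone c (Localization.AtPrime (coneLocalPrime (c j) hcj P))
  haveI := isLocalization_atPrime_coneLocalPrime c j P hP
  exact ridgeIdeal_le_of_hilbertSamuelFun_eq (isHomogeneousIdeal_fibreConeIdeal c)
    (fibreConeIdeal_le_chartConePrime c j P) hdS (Localization.AtPrime (coneLocalPrime (c j) hcj P)) (t := 0)
    (by rw [hB]; rfl)

/-- **THE DIRECTION OF A NEAR POINT LIES IN THE RIDGE OF THE FIBRE CONE** (every test algebra). With the hypotheses of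
`ridgeIdeal_fibreConeIdeal_le_chartConePrime_of_isNearRing`, for every commutative `k`-algebra `κ` and every ring
homomorphism `θ : 𝒪[𝔭/c_j] → κ` vanishing on `P` and compatible with `k → κ` on `𝒪`, the vector
`(θ(c_1/c_j), …, θ(c_n/c_j)) ∈ κⁿ` lies in `ridge κ (fibreConeIdeal c) = F(C_{X,D,x})(κ)`.
[cite: CossartJannsenSaito2020, Thm. 3.14] [cite: Giraud1975, Cor. 2.4] -/
theorem aeval_chartGen_mem_ridge_of_isNearRing (hO : IsUniversallyCatenaryRing O) [(𝔭).IsPrime]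
    [IsRegularLocalRing (O ⧸ 𝔭)] (hNF : (𝔭).IsNormallyFlat)
    (hP : P.comap (chartBase c j) = maximalIdeal O)
    (hOO' : ∀ r : O, algebraMap O O' r = (algebraMap (chartRing c j) O' : chartRing c j →+* O') (chartBase c j r))
    {N : ℕ} (hnear : IsNearRing O O' N)
    {κ : Type u} [CommRing κ] [Algebra (ResidueField O) κ] (θ : chartRing c j →+* κ)
    (hθP : ∀ x ∈ P, θ x = 0) (hθ : ∀ r : O, θ (chartBase c j r) = algebraMap (ResidueField O) κ (residue O r)) :
    (fun l => θ (chartGen c j l)) ∈ ridge κ (fibreConeIdeal c) := by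
  classical
  have hridge := ridgeIdeal_fibreConeIdeal_le_chartConePrime_of_isNearRing c j P O' hO hNF hP hOO' hnear
  have hI : IsHomogeneousIdeal (fibreConeIdeal c) := isHomogeneousIdeal_fibreConeIdeal c
  set u : Fin n → κ := fun l => θ (chartGen c j l)
  -- a form of `𝔓(P)` vanishes on the direction
  have hform : ∀ {m : ℕ} {g : MvPolynomial (Fin n) (ResidueField O)}, g.IsHomogeneous m →
      g ∈ chartConePrime c j P → aeval u g = 0 := by
    intro m g hg hmem
    obtain ⟨G, hG, rfl⟩ := exists_isHomogeneous_map_residue_eq hg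
    have hGP := (map_residue_mem_chartConePrime_iff c j P hP hG).mp hmem
    have hcomp : (algebraMap (ResidueField O) κ).comp (residue O) = θ.comp (chartBase c j) :=
      RingHom.ext fun r => (hθ r).symm
    rw [aeval_def, eval₂_map, hcomp, ← hθP _ hGP, hom_eval₂]
  refine mem_ridge_iff_forall_ridgeIdeal.mpr fun g hg => ?_
  rw [← sum_homogeneousComponent g, map_sum]
  exact Finset.sum_eq_zero fun m _ => hform (homogeneousComponent_isHomogeneous m g)
    (hridge (homogeneousComponent_mem_ridgeIdeal hI hg m))

/-- **RIDGE CONFINEMENT AT THE RESIDUE FIELD `κ(x')`** — the shape of the typed OURS `CampaignW42.RidgeConfinesChart`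
(p480040) with the fibre-cone ridge: for `𝒪` noetherian local universally catenary, `𝔭 = (c_1, …, c_n)` permissible,
every chart `j`, every prime `𝔴` of `𝒪[𝔭/c_j]` over `𝔫` whose local ring is NEAR to `𝒪` at level `N`, the tautological
direction `(ē_1, …, ē_n) ∈ κ(𝔴)ⁿ` lies in `F(C_{X,D,x})(κ(𝔴)) = ridge κ(𝔴) (fibreConeIdeal c)`, for the `k`-algebra
structure on `κ(𝔴)` induced by `𝒪 → 𝒪[𝔭/c_j] → κ(𝔴)`. [cite: CossartJannsenSaito2020, Thm. 3.14] [cite: Giraud1975, Cor. 2.4] -/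
theorem residue_chartGen_mem_ridge_of_isNearRing (hO : IsUniversallyCatenaryRing O) [(𝔭).IsPrime]
    [IsRegularLocalRing (O ⧸ 𝔭)] (hNF : (𝔭).IsNormallyFlat) (𝔴 : Ideal (chartRing c j)) [𝔴.IsPrime]
    (hπ : ∀ r ∈ maximalIdeal O,
      ((algebraMap (chartRing c j) (Ideal.ResidueField 𝔴)).comp (chartBase c j)) r = 0)
    {N : ℕ} (hnear : IsNearRing O (Localization.AtPrime 𝔴) N) :
    letI : Algebra (ResidueField O) (Ideal.ResidueField 𝔴) :=
      (Ideal.Quotient.lift (maximalIdeal O)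
        ((algebraMap (chartRing c j) (Ideal.ResidueField 𝔴)).comp (chartBase c j)) hπ).toAlgebra
    (fun l : Fin n =>
        (algebraMap (chartRing c j) (Ideal.ResidueField 𝔴) : chartRing c j →+* Ideal.ResidueField 𝔴)
          (chartGen c j l)) ∈ ridge (Ideal.ResidueField 𝔴) (fibreConeIdeal c) := by
  letI algκ : Algebra (ResidueField O) (Ideal.ResidueField 𝔴) :=
    (Ideal.Quotient.lift (maximalIdeal O)
      ((algebraMap (chartRing c j) (Ideal.ResidueField 𝔴)).comp (chartBase c j)) hπ).toAlgebra
  letI algO : Algebra O (Localization.AtPrime 𝔴) :=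
    ((algebraMap (chartRing c j) (Localization.AtPrime 𝔴)).comp (chartBase c j)).toAlgebra
  -- `𝔴` lies over `𝔫`
  have hP : 𝔴.comap (chartBase c j) = maximalIdeal O := by
    refine ((IsLocalRing.maximalIdeal.isMaximal O).eq_of_le (Ideal.IsPrime.ne_top inferInstance) fun r hr => ?_).symm
    rw [Ideal.mem_comap, ← Ideal.algebraMap_residueField_eq_zero]
    exact hπ r hr
  exact aeval_chartGen_mem_ridge_of_isNearRing c j 𝔴 (Localization.AtPrime 𝔴) hO hNF hP (fun _ => rfl) hnear
    (algebraMap (chartRing c j) (Ideal.ResidueField 𝔴)) (fun x hx => Ideal.algebraMap_residueField_eq_zero.mpr hx)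
    (fun _ => rfl)

end CampaignW42

end Summit.ResolutionOfSingularities.ResolutionOfSingularities.Theorems

end
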